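import Summits.QuantumFields.YangMills.Theorems.UV3BranchExpansionSocketWeightsSU
import Summits.QuantumFields.YangMills.Theorems.BalabanUVNodesN08HaarCompatibilityGuardCoreLawSU2AllL
import HarnessLib

/-!
# R3 (cell `ym3-torus`, YM₃ on T³ — a ladder RUNG, NOT d = 4, NOT infinite volume, NOT a mass gap, NOT the Clay problem) —
# **(hw-DISCHARGE AT `SU(2)` FOR EVERY BLOCK SIZE `L`) THE hTop SOCKET's WEIGHT BINDER WITH dag-n08-d's ∀-L (H_K) CONSTANT — NO RANGE HYPOTHESIS ON `L`**

DAG node N08 seat `pub-ymgap-dag-n08-d` g50 (docking twin of ✓`…GuardCoreLawSU2AllL`, ★★OWNER WORD 100 (ii), 2026-08-30); `--supports stmt-QuantumFields-19936 --as helper`.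
THEOREMS ONLY (0 `def`, 0 `sorry`, default heartbeats).

THE POINT.  w8 g12's ✓`UV3BranchExpansionSocketWeightsSU` supplies the socket's weight binder `hw` from ONE level-uniform (H_K) letter (★★★ `hw_of_fibre_law`) and
instantiates it on the three RANGES the tree's (H_K) suppliers reached (`L^{d−1} ≤ 9 ∕ 25 ∕ 400`, i.e. `L ≤ 20` at `d = 3`); its HYP-SAT paragraph records «for
`L ≥ 21` an explicit level-uniform (H_K) constant is NOT supplied».  dag-n08-d's ✓`…GuardCoreLawSU2AllL.fibre_law_le_su2_allL` now supplies it for EVERY `L` with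
`K(L) = ((L^{1−d}·sin 1·q₃)³q₃²)⁻¹·(2400π·L^{d−1}∕sin 1 + 3)⁴ + 1`; this file is the one-line instantiation:
 ★★ `hw_su2_allL` — `w s = (K(L) · h(1∕3+δ′)^{L^{d−1}−1} ∕ h(δ′))^{|s|}`, the shape of ✓`hw_su2_of_pow_le_four_hundred` WITHOUT its `hL`.

HYP-SAT (★★OWNER RULING №42): the binders are w8's verbatim minus `hL` — `T`∕`hT0`∕`hTs` the socket's hybrid trajectories (inhabited by ✓`exists_traj`), the standing
range `j + n ≤ m + K`, and `hh0 : h(δ′) ≠ 0` (every `δ′ > 0`, e.g. ✓`haarData_dist1_lt_one_div_ne_zero` at `1∕21`); nothing eventual ∕ vacuous.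
RECORD CURRENCY: SUPPLY for hTop ∀L ∕ NODE O B3 w.r.t. the 19936 v6 door (WORD 98 ∕ 17bs′) — 0 displayed hypotheses of PATH A∕B discharged; registries unchanged.

HONEST SCOPE.  A corollary BY NAME ([folklore] bookkeeping); the smallness NUMBER a segment needs at `L ≥ 21` (`2·K(L)·q(L)` against px13's K-agnostic threshold
✓`smallness_T3_anyL_of_ennreal_le`) is NOT here; nothing of hTop-∀L's consumers ∕ (O‴χₛ) ∕ EX ∕ `HistoryTailL` (19936) ∕ the rung ∕ d = 4 ∕ a mass gap ∕ Clay is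
proved.  YM₃ on T³ is rung R3 of the ladder, not the Clay problem; the Yang–Mills mass gap is NOT proved.

References: T. Bałaban, Commun. Math. Phys. **109** (1987) 249–301 [Balaban1987RG1] ((0.4) p. 253); T. Bałaban, Commun. Math. Phys. **102** (1985) 255–275
[Balaban1985UV3] ((2) p. 256).
-/

set_option autoImplicit false

noncomputable section

open MeasureTheory Set Function
open scoped ENNReal

namespace Summit.QuantumFields.YangMills.Theorems.UV3BranchExpansionSocketWeightsSU2AllL

open Literature.MathematicalPhysics.QuantumFieldTheory.Balaban1983to89
open Literature.MathematicalPhysics.QuantumFieldTheory.Balaban1983to89.AveragingRT (axialAvg)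
open Literature.MathematicalPhysics.QuantumFieldTheory.Balaban1983to89.BlockAveraging (Idx Small avgFun)
open Literature.MathematicalPhysics.QuantumFieldTheory.Balaban1983to89.BlockAveragingHaarAC (centralBond)
open Literature.MathematicalPhysics.QuantumFieldTheory.Balaban1983to89.ExpMeanLog (expMeanLogSU expMeanLogSU_δ measurable_expMeanLogSU_E)
open Summit.QuantumFields.YangMills.BalabanUVNodes.N08HaarCompatibilityGuardCoreLawSU2 (delta_two)
open Summit.QuantumFields.YangMills.BalabanUVNodes.N08HaarCompatibilityGuardCoreLawSU2AllL (fibre_law_le_su2_allL one_le_kallL_and_ne_top)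
open Summit.QuantumFields.YangMills.Theorems.UV3BranchExpansionSocketWeightsSU (hw_of_fibre_law)

variable {P : Params} {j : ℕ}

/-- ★★ **(hw-DISCHARGE AT `SU(2)`, EVERY BLOCK SIZE `L`)**: the socket's weight binder ✓`hw_of_fibre_law` fed with dag-n08-d's ✓`fibre_law_le_su2_allL` —
`dU_j((⋂_{τ∈s} {Small}) ∩ (T s′ n)⁻¹B) ≤ (K(L) · h(1∕3+δ′)^{L^{d−1}−1} ∕ h(δ′))^{|s|} · dU_{j+n}(B)` with
`K(L) = ((L^{1−d}·sin 1·q₃)³q₃²)⁻¹·(2400π∕(L^{1−d}·sin 1) + 3)⁴ + 1`, `q₃ = sin(π∕3)∕(π∕3)`, and NO range hypothesis on `L`.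
[cite: Balaban1987RG1, (0.4) p.253; Balaban1985UV3, (2) p.256] -/
theorem hw_su2_allL (n : ℕ)
    (T : Finset (Σ i : Fin n, PBond P (j + i + 1)) → (i : ℕ) → GaugeField P j (Matrix.specialUnitaryGroup (Fin 2) ℂ) →
      GaugeField P (j + i) (Matrix.specialUnitaryGroup (Fin 2) ℂ))
    (hT0 : ∀ s U, T s 0 U = U)
    (hTs : ∀ s (i : ℕ) (hi : i < n) U, T s (i + 1) U = fun c =>
      if c ∈ (Finset.univ.filter fun c' => (⟨⟨i, hi⟩, c'⟩ : Σ i : Fin n, PBond P (j + i + 1)) ∈ s) then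
        avgFun (expMeanLogSU : LoopAverage (Matrix.specialUnitaryGroup (Fin 2) ℂ)) (T s i U) c else axialAvg (T s i U) c)
    (hn : j + n ≤ P.m + P.K)
    (δ' : ℝ) (hh0 : (HaarData.haar : Measure (Matrix.specialUnitaryGroup (Fin 2) ℂ)) {g | dist1 g < δ'} ≠ 0) :
    ∀ s s' : Finset (Σ i : Fin n, PBond P (j + i + 1)), s' ⊆ s → ∀ B : Set (GaugeField P (j + n) (Matrix.specialUnitaryGroup (Fin 2) ℂ)), MeasurableSet B →
      fieldMeasure P j (Matrix.specialUnitaryGroup (Fin 2) ℂ)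
          ((⋂ τ ∈ s, {U | Small (expMeanLogSU : LoopAverage (Matrix.specialUnitaryGroup (Fin 2) ℂ)) (T s' τ.1 U) τ.2}) ∩ T s' n ⁻¹' B) ≤
        (((ENNReal.ofReal (((((P.L : ℝ) ^ (P.d - 1)))⁻¹ * Real.sin 1 * (Real.sin (Real.pi / 3) / (Real.pi / 3))) ^ 3 * (Real.sin (Real.pi / 3) / (Real.pi / 3)) ^ 2))⁻¹ *
              ENNReal.ofReal ((2400 * Real.pi / ((((P.L : ℝ) ^ (P.d - 1)))⁻¹ * Real.sin 1) + 3) ^ 4) + 1) *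
            ((HaarData.haar : Measure (Matrix.specialUnitaryGroup (Fin 2) ℂ)) {g | dist1 g < 1 / 3 + δ'} ^ (P.L ^ (P.d - 1) - 1) /
              (HaarData.haar : Measure (Matrix.specialUnitaryGroup (Fin 2) ℂ)) {g | dist1 g < δ'})) ^ s.card *
          fieldMeasure P (j + n) (Matrix.specialUnitaryGroup (Fin 2) ℂ) B := by
  obtain ⟨hK1, hKtop⟩ := one_le_kallL_and_ne_top (P := P)
  have h := hw_of_fibre_law (expMeanLogSU : LoopAverage (Matrix.specialUnitaryGroup (Fin 2) ℂ)) measurable_expMeanLogSU_E n T hT0 hTs hn hK1 hKtop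
    (fun k hk c U hadm => fibre_law_le_su2_allL hk c U hadm) δ' hh0
  rw [delta_two] at h
  exact h

end Summit.QuantumFields.YangMills.Theorems.UV3BranchExpansionSocketWeightsSU2AllL

end
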